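import Summits.Ventures.Crystal3D.Theorems.StickyWulffConstantNoReconstructionGainLowCoordAdhesion
import HarnessLib

/-!
# The adhesion atom at `(111)` from a LOCAL steep-balance rule; corollary: steep-or-flat overlayers

HONEST FRAMING. Part of the venture `Summits/Ventures/Crystal3D` (cell `crystal3d-full`), helper
`--supports` the crux `NoReconstructionGain` (stmt-Ventures-19144, route
`route-Ventures-StickyWulffConstant`).  The final form of the per-ball method at `ν = e₃`
(`h = √(2/3)`): the registered atom `stub_adhesion` (cross contacts `≤ D(X \ P) + C ρ`) holds for
every unit packing `X ⊇ P` in which every non-sample ball `q` obeys the LOCAL STEEP BALANCE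
`2·#{x ∼ q : Δz ≤ −h} + #{x ∼ q : |Δz| < h} ≤ 12` and its mirror image (`Δz = x₂ − q₂`) —
the flat-profile weighted-kissing inequality of the planner's WK line, taken as a hypothesis
ball by ball (`adhesion111_of_localSteepBalance`).  It holds automatically for balls with at most
nine contacts (cone lemma; this recovers `lowCoordAdhesion111_nine`) and for balls all of whose
bonds are flat (`|Δz| ≤ 1/5`) or steep (`|Δz| ≥ h`) (cone + band lemmas), in any mixture; hence
the corollary `steepFlatAdhesion111`: the atom for every overlayer whose NON-SAMPLE balls have only
flat or steep bonds — the steep-or-flat rung in the atom's own (registered) shape, with the bond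
hypothesis only where it matters.  The WK no-go (p1 g12) says exactly that the local rule fails
for some 12-coordinated balls with oblique bonds, so this file is the boundary of the method.

Proof: as in `…LowCoordAdhesion.lean` (slab potential `Φ`, weights `2/1/0`, rim count, kissing
number), with the per-ball bound supplied by the hypothesis through `Φ x − Φ q ≥ Δz` above the
slab (`≥ −Δz` below; inside the slab every weight is `≤ 1` and the kissing number suffices).

WHAT THIS IS NOT: the atom for overlayers violating the local rule (non-Barlow 12-coordination);
other normals; rung F-C1 not moved.
-/

noncomputable section

namespace Summit.Ventures.Crystal3D.Theorems

open Summit.Ventures.Crystal3D Finset Real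
open Literature.MathematicalPhysics.StatisticalMechanics (barlowPos barlowStacking fccStacking
  constHagg barlowPos_apply_two orderedContacts contactDeficiency)
open scoped InnerProductSpace

/-- **The adhesion atom at `ν = e₃` from local steep balance.**  With `R = 4`, `C = 450π`,
`h = √(2/3)`: for `ρ ≥ R`, every finite unit packing `X ⊇ P`, `P` the fcc `(111)` slab sample,
such that every `q ∈ X \ P` satisfies `2·#{x ∼ q : x₂ − q₂ ≤ −h} + #{x ∼ q : |x₂ − q₂| < h} ≤ 12`
and the mirrored inequality: `#{(p, q) ∈ P × (X \ P) : dist p q = 1} ≤ D(X \ P) + C ρ`. -/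
theorem adhesion111_of_localSteepBalance :
    ∃ R C : ℝ, 1 ≤ R ∧ ∀ ρ : ℝ, R ≤ ρ → ∀ X P : Finset (EuclideanSpace ℝ (Fin 3)),
      (∀ p ∈ X, ∀ q ∈ X, p ≠ q → 1 ≤ dist p q) → P ⊆ X →
      (∀ p, p ∈ P ↔ (p ∈ fccStacking 1 (Real.sqrt (2 / 3)) ∧
        -(2 * R) ≤ ⟪p, EuclideanSpace.single (2 : Fin 3) (1 : ℝ)⟫_ℝ ∧
        ⟪p, EuclideanSpace.single (2 : Fin 3) (1 : ℝ)⟫_ℝ ≤ -R ∧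
        ‖p‖ ^ 2 - ⟪p, EuclideanSpace.single (2 : Fin 3) (1 : ℝ)⟫_ℝ ^ 2 ≤ ρ ^ 2)) →
      (∀ q ∈ X \ P,
        2 * (X.filter fun x => dist q x = 1 ∧ x 2 - q 2 ≤ -Real.sqrt (2 / 3)).card +
          (X.filter fun x => dist q x = 1 ∧ -Real.sqrt (2 / 3) < x 2 - q 2 ∧
            x 2 - q 2 < Real.sqrt (2 / 3)).card ≤ 12 ∧
        2 * (X.filter fun x => dist q x = 1 ∧ Real.sqrt (2 / 3) ≤ x 2 - q 2).card +
          (X.filter fun x => dist q x = 1 ∧ -Real.sqrt (2 / 3) < x 2 - q 2 ∧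
            x 2 - q 2 < Real.sqrt (2 / 3)).card ≤ 12) →
      ((((P ×ˢ (X \ P)).filter fun pq => dist pq.1 pq.2 = 1).card : ℕ) : ℝ) ≤
        contactDeficiency (X \ P) + C * ρ := by
  classical
  refine ⟨4, 450 * Real.pi, by norm_num, ?_⟩
  intro ρ hρ X P hX hPX hP hloc
  obtain ⟨hh2, hh45, hh89⟩ := sqrt_two_thirds_bounds
  set h : ℝ := Real.sqrt (2 / 3) with hhdef
  have hhpos : 0 < h := by linarith
  -- the sample in coordinates
  have hinner : ∀ p : EuclideanSpace ℝ (Fin 3), ⟪p, EuclideanSpace.single (2 : Fin 3) (1 : ℝ)⟫_ℝ = p 2 :=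
    fun p => by simp [EuclideanSpace.inner_single_right]
  have hlat : ∀ p : EuclideanSpace ℝ (Fin 3), ‖p‖ ^ 2 - (p 2) ^ 2 = p 0 ^ 2 + p 1 ^ 2 := fun p => by
    rw [EuclideanSpace.real_norm_sq_eq, Fin.sum_univ_three]; ring
  have hP' : ∀ p, p ∈ P ↔ (p ∈ fccStacking 1 (Real.sqrt (2 / 3)) ∧ -8 ≤ p 2 ∧ p 2 ≤ -4 ∧
      p 0 ^ 2 + p 1 ^ 2 ≤ ρ ^ 2) := by
    intro p
    rw [hP p, hinner, hlat]
    constructor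
    · rintro ⟨a, b, c, d⟩; exact ⟨a, by linarith, by linarith, d⟩
    · rintro ⟨a, b, c, d⟩; exact ⟨a, by linarith, by linarith, d⟩
  -- the slab potential and the weights
  set Φ : EuclideanSpace ℝ (Fin 3) → ℝ := fun y => max (y 2 + 5 * h) (max (-(9 * h) - y 2) 0)
    with hΦdef
  have hΦ : ∀ y, Φ y = max (y 2 + 5 * h) (max (-(9 * h) - y 2) 0) := fun y => rfl
  have hΦ0 : ∀ y, 0 ≤ Φ y := fun y => le_trans (le_max_right _ _) (le_max_right _ _)
  have hΦP : ∀ p ∈ P, Φ p = 0 := by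
    intro p hp
    obtain ⟨hΛ, h1, h2, -⟩ := (hP' p).1 hp
    obtain ⟨hz1, hz2⟩ := slab_height_bounds hΛ h1 h2
    rw [hΦ, max_eq_right (le_trans (by linarith) (le_max_right _ _)), max_eq_right (by linarith)]
  set w : EuclideanSpace ℝ (Fin 3) → EuclideanSpace ℝ (Fin 3) → ℝ := fun q x =>
    if Φ x - Φ q ≤ -h then 2 else if Φ x - Φ q < h then 1 else 0 with hwdef
  have hw_symm : ∀ q x, w q x + w x q = 2 := by
    intro q x
    simp only [hwdef]
    have e : Φ q - Φ x = -(Φ x - Φ q) := by ring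
    rw [e]
    rcases le_or_gt (Φ x - Φ q) (-h) with h1 | h1
    · rw [if_pos h1, if_neg (by linarith), if_neg (by linarith)]; norm_num
    · rw [if_neg (not_le.2 h1)]
      rcases lt_or_ge (Φ x - Φ q) h with h2 | h2
      · rw [if_pos h2, if_neg (by linarith), if_pos (by linarith)]; norm_num
      · rw [if_neg (not_lt.2 h2), if_pos (by linarith)]; norm_num
  set Q := X \ P with hQ
  have hQX : ∀ q ∈ Q, q ∈ X ∧ q ∉ P := fun q hq => mem_sdiff.1 hq
  -- (1) per-ball bound from the local rule
  have hΦlo : ∀ y, y 2 + 5 * h ≤ Φ y := fun y => le_max_left _ _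
  have hΦlo' : ∀ y, -(9 * h) - y 2 ≤ Φ y := fun y => le_trans (le_max_left _ _) (le_max_right _ _)
  have hball : ∀ q ∈ Q, ∑ x ∈ X, (if dist q x = 1 then w q x else 0) ≤ 12 := by
    intro q hq
    obtain ⟨hup_rule, hdown_rule⟩ := hloc q hq
    set N := X.filter fun x => dist q x = 1 with hN
    rw [← sum_filter]
    -- a comparison weight `w'` computed from a lower bound `d x ≤ Φ x - Φ q`
    have hmono : ∀ (d : ℝ) (x : EuclideanSpace ℝ (Fin 3)), d ≤ Φ x - Φ q →
        w q x ≤ (if d ≤ -h then 2 else if d < h then 1 else 0) := by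
      intro d x hd
      simp only [hwdef]
      by_cases h1 : Φ x - Φ q ≤ -h
      · rw [if_pos h1, if_pos (by linarith)]
      · rw [if_neg h1]
        by_cases h2 : Φ x - Φ q < h
        · rw [if_pos h2]
          by_cases h3 : d ≤ -h
          · rw [if_pos h3]; norm_num
          · rw [if_neg h3, if_pos (by linarith)]
        · rw [if_neg h2]; split_ifs <;> norm_num
    -- the sum of the comparison weights is `2·#steep + #middle`
    have hsumw : ∀ d : EuclideanSpace ℝ (Fin 3) → ℝ,
        ∑ x ∈ N, (if d x ≤ -h then (2 : ℝ) else if d x < h then 1 else 0) =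
          2 * ((X.filter fun x => dist q x = 1 ∧ d x ≤ -h).card : ℝ) +
            ((X.filter fun x => dist q x = 1 ∧ -h < d x ∧ d x < h).card : ℝ) := by
      intro d
      have e : ∀ x, (if d x ≤ -h then (2 : ℝ) else if d x < h then 1 else 0) =
          2 * (if d x ≤ -h then (1 : ℝ) else 0) + (if -h < d x ∧ d x < h then 1 else 0) := by
        intro x
        by_cases h1 : d x ≤ -h
        · rw [if_pos h1, if_pos h1, if_neg (fun hh => by linarith [hh.1])]; norm_num
        · rw [if_neg h1, if_neg h1]
          by_cases h2 : d x < h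
          · rw [if_pos h2, if_pos ⟨not_le.1 h1, h2⟩]; norm_num
          · rw [if_neg h2, if_neg (fun hh => h2 hh.2)]; norm_num
      rw [sum_congr rfl (fun x _ => e x), sum_add_distrib, ← mul_sum, sum_boole, sum_boole, hN,
        filter_filter, filter_filter]
    by_cases hup : -(5 * h) < q 2
    · -- above the slab: `Φ x - Φ q ≥ x₂ - q₂`
      have hΦq : Φ q = q 2 + 5 * h := by
        show max _ _ = _
        rw [max_eq_left]; exact max_le (by linarith) (by linarith)
      calc ∑ x ∈ N, w q x ≤ ∑ x ∈ N, (if x 2 - q 2 ≤ -h then (2 : ℝ) else if x 2 - q 2 < h then 1 else 0) :=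
            sum_le_sum fun x _ => hmono _ x (by rw [hΦq]; linarith [hΦlo x])
        _ ≤ 12 := by
            rw [hsumw (fun x => x 2 - q 2)]
            exact_mod_cast hup_rule
    by_cases hdown : q 2 < -(9 * h)
    · -- below the slab: `Φ x - Φ q ≥ -(x₂ - q₂)`
      have hΦq : Φ q = -(9 * h) - q 2 := by
        show max _ _ = _
        rw [max_eq_right_of_lt (by
          calc q 2 + 5 * h < -(9 * h) - q 2 := by linarith
            _ ≤ max (-(9 * h) - q 2) 0 := le_max_left _ _), max_eq_left (by linarith)]
      calc ∑ x ∈ N, w q x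
          ≤ ∑ x ∈ N, (if -(x 2 - q 2) ≤ -h then (2 : ℝ) else if -(x 2 - q 2) < h then 1 else 0) :=
            sum_le_sum fun x _ => hmono _ x (by rw [hΦq]; linarith [hΦlo' x])
        _ ≤ 12 := by
            rw [hsumw (fun x => -(x 2 - q 2))]
            have e1 : (X.filter fun x => dist q x = 1 ∧ -(x 2 - q 2) ≤ -h) =
                X.filter fun x => dist q x = 1 ∧ h ≤ x 2 - q 2 :=
              filter_congr fun x _ => by constructor <;> rintro ⟨a, b⟩ <;> exact ⟨a, by linarith⟩
            have e2 : (X.filter fun x => dist q x = 1 ∧ -h < -(x 2 - q 2) ∧ -(x 2 - q 2) < h) =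
                X.filter fun x => dist q x = 1 ∧ -h < x 2 - q 2 ∧ x 2 - q 2 < h :=
              filter_congr fun x _ => by
                constructor <;> rintro ⟨a, b, c⟩ <;> exact ⟨a, by linarith, by linarith⟩
            rw [e1, e2]
            exact_mod_cast hdown_rule
    · -- inside the slab: every weight is at most `1`, and a ball has at most twelve partners
      have hΦq : Φ q = 0 := by
        show max _ _ = _
        rw [max_eq_right (le_trans (by linarith [not_lt.1 hup]) (le_max_right _ _)),
          max_eq_right (by linarith [not_lt.1 hdown])]
      have hw1 : ∀ x ∈ N, w q x ≤ 1 := by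
        intro x _
        simp only [hwdef, hΦq, sub_zero]
        rw [if_neg (by linarith [hΦ0 x, hhpos])]
        split_ifs <;> norm_num
      calc ∑ x ∈ N, w q x ≤ ∑ _x ∈ N, (1 : ℝ) := sum_le_sum hw1
        _ = (N.card : ℝ) := by simp
        _ ≤ 12 := by exact_mod_cast card_partners_le_twelve X hX q
  have h12 : ∑ q ∈ Q, ∑ x ∈ X, (if dist q x = 1 then w q x else 0) ≤ 12 * (Q.card : ℝ) := by
    calc ∑ q ∈ Q, ∑ x ∈ X, (if dist q x = 1 then w q x else 0) ≤ ∑ _q ∈ Q, (12 : ℝ) :=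
          sum_le_sum hball
      _ = 12 * (Q.card : ℝ) := by rw [sum_const, nsmul_eq_mul, mul_comm]
  -- (2) split the inner sum over `X = Q ∪ P`
  have hXQP : X = Q ∪ P := by rw [hQ, sdiff_union_of_subset hPX]
  have hdisj : Disjoint Q P := by rw [hQ]; exact sdiff_disjoint
  have hsplit : ∑ q ∈ Q, ∑ x ∈ X, (if dist q x = 1 then w q x else 0) =
      (∑ q ∈ Q, ∑ x ∈ Q, (if dist q x = 1 then w q x else 0)) +
        ∑ q ∈ Q, ∑ p ∈ P, (if dist q p = 1 then w q p else 0) := by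
    rw [← sum_add_distrib]
    refine sum_congr rfl fun q _ => ?_
    rw [hXQP, sum_union hdisj]
  -- (2a) the `Q`-`Q` part is `orderedContacts Q`
  have hQQ : ∑ q ∈ Q, ∑ x ∈ Q, (if dist q x = 1 then w q x else 0) = (orderedContacts Q : ℝ) := by
    set S := ∑ q ∈ Q, ∑ x ∈ Q, (if dist q x = 1 then w q x else 0) with hS
    have hS' : S = ∑ q ∈ Q, ∑ x ∈ Q, (if dist q x = 1 then w x q else 0) := by
      rw [hS, sum_comm]
      refine sum_congr rfl fun x _ => sum_congr rfl fun q _ => ?_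
      rw [dist_comm]
    have hsum2 : (∑ q ∈ Q, ∑ x ∈ Q, (if dist q x = 1 then w q x else 0)) +
        (∑ q ∈ Q, ∑ x ∈ Q, (if dist q x = 1 then w x q else 0)) =
        ∑ q ∈ Q, ∑ x ∈ Q, (if dist q x = 1 then (2 : ℝ) else 0) := by
      rw [← sum_add_distrib]
      refine sum_congr rfl fun q _ => ?_
      rw [← sum_add_distrib]
      refine sum_congr rfl fun x _ => ?_
      by_cases hqx : dist q x = 1
      · rw [if_pos hqx, if_pos hqx, if_pos hqx]; exact hw_symm q x
      · rw [if_neg hqx, if_neg hqx, if_neg hqx]; norm_num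
    have h2S : 2 * S = ∑ q ∈ Q, ∑ x ∈ Q, (if dist q x = 1 then (2 : ℝ) else 0) := by
      rw [two_mul, ← hsum2, ← hS', hS]
    rw [orderedContacts_eq_sum_sum]
    have : ∑ q ∈ Q, ∑ x ∈ Q, (if dist q x = 1 then (2 : ℝ) else 0) =
        2 * ∑ q ∈ Q, ∑ x ∈ Q, (if dist q x = 1 then (1 : ℝ) else 0) := by
      rw [mul_sum]; refine sum_congr rfl fun q _ => ?_
      rw [mul_sum]; refine sum_congr rfl fun x _ => ?_
      split_ifs <;> norm_num
    linarith
  -- (2b) the cross part: weight `2` except at rim sites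
  set rim := P.filter fun p => (ρ - 2) ^ 2 < p 0 ^ 2 + p 1 ^ 2 with hrim
  have hwP : ∀ q ∈ Q, ∀ p ∈ P, dist q p = 1 →
      (2 : ℝ) - (if p ∈ rim then 1 else 0) ≤ w q p := by
    intro q hq p hp hqp
    have hΦp := hΦP p hp
    show (2 : ℝ) - (if p ∈ rim then 1 else 0) ≤
      (if Φ p - Φ q ≤ -h then 2 else if Φ p - Φ q < h then 1 else 0)
    rw [hΦp, zero_sub]
    by_cases hge : h ≤ Φ q
    · rw [if_pos (show -Φ q ≤ -h by linarith)]
      by_cases hpr : p ∈ rim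
      · rw [if_pos hpr]; norm_num
      · rw [if_neg hpr]; norm_num
    · have hlt := not_le.1 hge
      rw [if_neg (show ¬ (-Φ q ≤ -h) from not_le.2 (by linarith)),
        if_pos (show -Φ q < h by linarith [hΦ0 q])]
      have hprim : p ∈ rim := by
        rw [hrim, mem_filter]
        refine ⟨hp, ?_⟩
        exact rim_of_lowPotential_partner ρ hρ X P hX hPX hP' Φ hΦ p q (hQX q hq).1 (hQX q hq).2
          (by rw [dist_comm]; exact hqp) hlt
      rw [if_pos hprim]; norm_num
  have hcross : ((((P ×ˢ Q).filter fun pq => dist pq.1 pq.2 = 1).card : ℕ) : ℝ) =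
      ∑ q ∈ Q, ∑ p ∈ P, (if dist q p = 1 then (1 : ℝ) else 0) := by
    rw [card_crossContacts_eq_sum_sum, sum_comm]
    refine sum_congr rfl fun q _ => sum_congr rfl fun p _ => ?_
    rw [dist_comm]
  have hrim12 : ∑ q ∈ Q, ∑ p ∈ P, (if dist q p = 1 then (if p ∈ rim then (1 : ℝ) else 0) else 0)
      ≤ 12 * (rim.card : ℝ) := by
    rw [sum_comm]
    have hz : ∀ p ∈ P, p ∉ rim →
        ∑ q ∈ Q, (if dist q p = 1 then (if p ∈ rim then (1 : ℝ) else 0) else 0) = 0 := by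
      intro p _ hpr
      exact sum_eq_zero fun q _ => by simp [hpr]
    rw [← sum_filter_add_sum_filter_not P (fun p => p ∈ rim), sum_congr rfl (fun p hp =>
      hz p (mem_filter.1 hp).1 (mem_filter.1 hp).2), sum_const_zero, add_zero]
    have hPr : P.filter (fun p => p ∈ rim) = rim := by
      ext p; rw [mem_filter, hrim, mem_filter]; tauto
    rw [hPr]
    have hle : ∀ p ∈ rim, ∑ q ∈ Q, (if dist q p = 1 then (if p ∈ rim then (1 : ℝ) else 0) else 0)
        ≤ 12 := by
      intro p hpr
      have hpX : p ∈ X := hPX (mem_filter.1 hpr).1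
      calc ∑ q ∈ Q, (if dist q p = 1 then (if p ∈ rim then (1 : ℝ) else 0) else 0)
          = ∑ q ∈ Q, (if dist p q = 1 then (1 : ℝ) else 0) := by
            refine sum_congr rfl fun q _ => ?_
            rw [if_pos hpr, dist_comm]
        _ = ((Q.filter fun q => dist p q = 1).card : ℝ) := by rw [sum_boole]
        _ ≤ ((X.filter fun q => dist p q = 1).card : ℝ) := by
            exact_mod_cast card_le_card (filter_subset_filter _ (by rw [hQ]; exact sdiff_subset))
        _ ≤ 12 := by exact_mod_cast card_partners_le_twelve X hX p
    calc ∑ p ∈ rim, ∑ q ∈ Q, (if dist q p = 1 then (if p ∈ rim then (1 : ℝ) else 0) else 0)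
        ≤ ∑ _p ∈ rim, (12 : ℝ) := sum_le_sum hle
      _ = 12 * (rim.card : ℝ) := by rw [sum_const, nsmul_eq_mul, mul_comm]
  have hQP : 2 * ((((P ×ˢ Q).filter fun pq => dist pq.1 pq.2 = 1).card : ℕ) : ℝ) -
      12 * (rim.card : ℝ) ≤ ∑ q ∈ Q, ∑ p ∈ P, (if dist q p = 1 then w q p else 0) := by
    rw [hcross, mul_sum]
    have hpt : ∀ q ∈ Q, 2 * ∑ p ∈ P, (if dist q p = 1 then (1 : ℝ) else 0) -
        ∑ p ∈ P, (if dist q p = 1 then (if p ∈ rim then (1 : ℝ) else 0) else 0) ≤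
        ∑ p ∈ P, (if dist q p = 1 then w q p else 0) := by
      intro q hq
      rw [mul_sum, ← sum_sub_distrib]
      refine sum_le_sum fun p hp => ?_
      by_cases hqp : dist q p = 1
      · rw [if_pos hqp, if_pos hqp, if_pos hqp]
        have := hwP q hq p hp hqp; linarith
      · rw [if_neg hqp, if_neg hqp, if_neg hqp]; norm_num
    have := sum_le_sum hpt
    rw [sum_sub_distrib] at this
    linarith [hrim12]
  -- (3) assemble
  have hrimle : (rim.card : ℝ) ≤ 75 * Real.pi * ρ := card_rim_le ρ hρ P hP'
  have hmain : (orderedContacts Q : ℝ) +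
      (2 * ((((P ×ˢ Q).filter fun pq => dist pq.1 pq.2 = 1).card : ℕ) : ℝ) -
        12 * (rim.card : ℝ)) ≤ 12 * (Q.card : ℝ) := by
    rw [← hQQ]; linarith [hsplit, h12, hQP]
  show ((((P ×ˢ Q).filter fun pq => dist pq.1 pq.2 = 1).card : ℕ) : ℝ) ≤
    contactDeficiency Q + 450 * Real.pi * ρ
  unfold contactDeficiency
  nlinarith [hmain, hrimle, Real.pi_pos]


/-- **`SteepFlatAdhesion111`** — the steep-or-flat rung in the atom's registered shape.  With
`R = 4`, `C = 450π`: the adhesion atom at `ν = e₃` holds for every finite unit packing `X ⊇ P`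
(`P` the fcc `(111)` slab sample) in which every bond AT A NON-SAMPLE BALL is flat
(`|Δz| ≤ 1/5`) or steep (`|Δz| ≥ √(2/3)`): `#{(p,q) ∈ P × (X \ P) : dist p q = 1} ≤ D(X \ P) + Cρ`.
(Local steep balance: `≤ 3` steep partners on each side by the cone lemma, `≤ 6` flat ones by
the band lemma, no oblique ones.) -/
theorem steepFlatAdhesion111 :
    ∃ R C : ℝ, 1 ≤ R ∧ ∀ ρ : ℝ, R ≤ ρ → ∀ X P : Finset (EuclideanSpace ℝ (Fin 3)),
      (∀ p ∈ X, ∀ q ∈ X, p ≠ q → 1 ≤ dist p q) → P ⊆ X →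
      (∀ p, p ∈ P ↔ (p ∈ fccStacking 1 (Real.sqrt (2 / 3)) ∧
        -(2 * R) ≤ ⟪p, EuclideanSpace.single (2 : Fin 3) (1 : ℝ)⟫_ℝ ∧
        ⟪p, EuclideanSpace.single (2 : Fin 3) (1 : ℝ)⟫_ℝ ≤ -R ∧
        ‖p‖ ^ 2 - ⟪p, EuclideanSpace.single (2 : Fin 3) (1 : ℝ)⟫_ℝ ^ 2 ≤ ρ ^ 2)) →
      (∀ q ∈ X \ P, ∀ x ∈ X, dist q x = 1 →
        |x 2 - q 2| ≤ 1 / 5 ∨ Real.sqrt (2 / 3) ≤ |x 2 - q 2|) →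
      ((((P ×ˢ (X \ P)).filter fun pq => dist pq.1 pq.2 = 1).card : ℕ) : ℝ) ≤
        contactDeficiency (X \ P) + C * ρ := by
  classical
  obtain ⟨R, C, hR, hmain⟩ := adhesion111_of_localSteepBalance
  refine ⟨R, C, hR, fun ρ hρ X P hX hPX hP hsf => hmain ρ hρ X P hX hPX hP fun q hq => ?_⟩
  obtain ⟨hh2, hh45, _⟩ := sqrt_two_thirds_bounds
  set h : ℝ := Real.sqrt (2 / 3) with hhdef
  have hh0 : 0 ≤ h := Real.sqrt_nonneg _
  have hh58 : (5 : ℝ) / 8 < h ^ 2 := by rw [hh2]; norm_num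
  have hqX : q ∈ X := (mem_sdiff.1 hq).1
  -- the partners of `q` as unit vectors
  have himg : ∀ (S : Finset (EuclideanSpace ℝ (Fin 3))), (∀ x ∈ S, x ∈ X ∧ dist q x = 1) →
      (S.image fun x => x - q).card = S.card ∧
      (∀ u ∈ S.image (fun x => x - q), ‖u‖ = 1) ∧
      (∀ u ∈ S.image (fun x => x - q), ∀ w ∈ S.image (fun x => x - q), u ≠ w →
        ⟪u, w⟫_ℝ ≤ 1 / 2) := by
    intro S hS
    refine ⟨card_image_of_injOn fun x _ y _ hxy => sub_left_injective hxy, ?_, ?_⟩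
    · intro u hu
      obtain ⟨x, hx, rfl⟩ := mem_image.1 hu
      rw [← dist_eq_norm, dist_comm]; exact (hS x hx).2
    · intro u hu w hw huw
      obtain ⟨x, hx, rfl⟩ := mem_image.1 hu
      obtain ⟨y, hy, rfl⟩ := mem_image.1 hw
      have hux : ‖x - q‖ = 1 := by rw [← dist_eq_norm, dist_comm]; exact (hS x hx).2
      have huy : ‖y - q‖ = 1 := by rw [← dist_eq_norm, dist_comm]; exact (hS y hy).2
      refine inner_le_half_of_one_le_dist hux huy ?_
      rw [dist_eq_norm, sub_sub_sub_cancel_right, ← dist_eq_norm]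
      exact hX x (hS x hx).1 y (hS y hy).1 fun hxy => huw (by rw [hxy])
  -- steep partners below / above: at most three each
  have hdown : (X.filter fun x => dist q x = 1 ∧ x 2 - q 2 ≤ -h).card ≤ 3 := by
    obtain ⟨hc, hu, hs⟩ := himg (X.filter fun x => dist q x = 1 ∧ x 2 - q 2 ≤ -h)
      (fun x hx => ⟨(mem_filter.1 hx).1, (mem_filter.1 hx).2.1⟩)
    rw [← hc]
    refine card_negCone_le_three h hh0 hh58 hu (fun u hu' => ?_) hs
    obtain ⟨x, hx, rfl⟩ := mem_image.1 hu'
    rw [PiLp.sub_apply]; exact (mem_filter.1 hx).2.2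
  have hup : (X.filter fun x => dist q x = 1 ∧ h ≤ x 2 - q 2).card ≤ 3 := by
    obtain ⟨hc, hu, hs⟩ := himg (X.filter fun x => dist q x = 1 ∧ h ≤ x 2 - q 2)
      (fun x hx => ⟨(mem_filter.1 hx).1, (mem_filter.1 hx).2.1⟩)
    rw [← hc]
    refine card_cone_le_three h hh0 hh58 hu (fun u hu' => ?_) hs
    obtain ⟨x, hx, rfl⟩ := mem_image.1 hu'
    rw [PiLp.sub_apply]; exact (mem_filter.1 hx).2.2
  -- middle partners are flat: at most six
  have hmid : (X.filter fun x => dist q x = 1 ∧ -h < x 2 - q 2 ∧ x 2 - q 2 < h).card ≤ 6 := by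
    obtain ⟨hc, hu, hs⟩ := himg (X.filter fun x => dist q x = 1 ∧ -h < x 2 - q 2 ∧ x 2 - q 2 < h)
      (fun x hx => ⟨(mem_filter.1 hx).1, (mem_filter.1 hx).2.1⟩)
    rw [← hc]
    refine card_thin_band_le_six hu (fun u hu' => ?_) hs
    obtain ⟨x, hx, rfl⟩ := mem_image.1 hu'
    obtain ⟨hxX, hd, h1, h2⟩ := mem_filter.1 hx
    rw [PiLp.sub_apply]
    rcases hsf q hq x hxX hd with hflat | hsteep
    · exact hflat.trans (by norm_num)
    · exfalso
      rcases le_abs.1 hsteep with h3 | h3 <;> linarith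
  constructor <;> omega

end Summit.Ventures.Crystal3D.Theorems

end
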